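import Summits.AtomisticToContinuum.FouriersLaw.Theorems.BondHeatUncertaintyExtensiveSnapshotIrreversibilityEnergyWindowKernelLossLadder

/-!
# Crux `ExtensiveSnapshotIrreversibility` (stmt-AtomisticToContinuum-9121): the split Duhamel formula beneath the kernel leaf S3

Cell decomp-a2c, lens «grading / quantitative ladder», generation 75, critic row 1022 (3): route (γ)
of the g74 memo, TYPED AND GLUED.  The kernel leaf S3 `KernelTemperatureLipschitz` (time-one
kernel of the pinned chain `|δ|`-Lipschitz in the bath temperatures `T ± δ/2`, weights
`e^{θH} → e^{θ'H}`) is reduced to three pieces by the second-order perturbation formula with ONE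
momentum derivative on each side:

  `P^δ_1 h − P^0_1 h = (γδ/2) ∫₀¹ P^δ_s (∂²_{p_0} − ∂²_{p_{N−1}}) P^0_{1−s} h ds`
  (`L^δ − L^0 = (γδ/2)(∂²_{p_0} − ∂²_{p_{N−1}})`, the friction being temperature-independent), and
  `∫ ∂_{p_b}(∂_{p_b} u) dP^δ_s(z)` is paired as (derivative of the density of `P^δ_s(z,·)` along
  `p_b`) × (derivative of `u = P^0_{1−s}h` along `p_b`), each costing the HALF singularity
  `s^{-1/2}` resp. `(1−s)^{-1/2}` of a directly-noised direction — integrable on `(0,1)` because the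
  two singularities sit at opposite ends (Young's inequality fails exactly at `½ + ½ = 1`; the
  split `s^{-b}(1−s)^{-a} ≤ 2 s^{-b} + 2 (1−s)^{-a}` does not).

PIECES (all WEAKER than the summit: finite time, fixed `N`, no steady state; typed with exponent
RANGES `a < 1`, never the expected value `½`, D-0019 4c (iv)):
* (D)  `KernelTemperatureDuhamel` — the identity above, as an interval integral of the bath-site
  integrands `duhamelIntegrand`, plus `C¹`-regularity of `∂_{p_b} P^0_r h` (`0 < r ≤ 1`).
  [INSTRUMENTABLE: semigroup calculus from the tree's Dynkin identity `pinnedChain_dynkin`,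
  hypoelliptic smoothness `langevin_transitionDensity_of_hormander` and the growth control (3.4);
  no new idea, much Lean.]
* (G1) `EqualTemperatureBathGradient` — the u-side: `|∂_{p_b} P^0_r h(w)| ≤ C r^{-a} e^{θ₁H(w)}`
  for measurable `|h| ≤ e^{θH}`, `θ < θ₁`, `0 < r ≤ 1`, `b` a BATH site, some `a ∈ [0,1)`
  (expected `a = ½`: the Kolmogorov scaling of a noised direction, `(t,1)Σ_t⁻¹(t,1)ᵀ = 4/t` for
  `dX = Y dt, dY = dW`).  [ATTACKABLE-L: Bismut–Malliavin gradient estimate through the chain,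
  Lyapunov-weighted; the loss grade of file L enters HERE and is absorbed by `θ < θ₁`.]
* (G1*) `PerturbedKernelMomentumIBP` — the density side, UNIFORM in `|δ| < δ₀`:
  `|∫ ∂_{p_b} g dP^δ_s(z)| ≤ C s^{-b} M e^{θ₂H(z)}` for `g ∈ C¹`, `|g| ≤ M e^{θ₁H}`, `θ₁ < θ₂`,
  some `b ∈ [0,1)` (Malliavin integration by parts `E[(∂_b g)(Z_s)] = E[g(Z_s) H_b]`,
  `‖H_b‖_q ≲ s^{-1/2}`; stated for `C¹` test functions ONLY — over all measurable `g` with the total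
  `partialP` it is false, g74 dead line).  [ATTACKABLE-L.]
* ★ `kernelTemperatureLipschitz_of_duhamelSplit : (D) → (G1) → (G1*) → S3` PROVED (rates
  `θ < θ₁ := (θ+θ')/2 < θ'`; constant `γ/2 · ∫₀¹ 2C₁C₂(2s^{-b} + 2(1−s)^{-a}) ds`), and the junction
  `K_fix ⟸ A0 ∧ A2 ∧ (D) ∧ (G1) ∧ (G1*) ∧ A3p ∧ A4` (`snapshotKLUpperExpansion_of_atoms₇M`).

Why this is novel: the response literature for heat-conduction chains perturbs the DRIFT or uses
`L²(μ_T)` duality (rate ceiling `1/(2T)`, g73/g74 dead lines); a temperature perturbation lives in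
the diffusion coefficient (Girsanov-singular), and the symmetric split of `∂²_{p_b}` into a Bismut
half and an integration-by-parts half — each a `t^{-1/2}` estimate in a directly-noised direction
of a hypoelliptic chain — is, as far as the g74/g75 presearch finds (corpus fts+vec and galaxy NULL
for chains; nearest: Wang–Zhang 2013 Thm 1.1(3) and Guillin–Wang 2012 for FULL momentum noise,
Eckmann–Hairer 2000 §3 smoothing for chains without rates in `t`), not in print for this model.
Calibration: for the harmonic chain both halves are explicit Gaussian computations and S3 holds at
grade 0 (file L, `HOME/decomp-a2c-lens-1/g75/numerics/HARMONIC-FALSIFIER.md`).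

References: N. Cuneo, J.-P. Eckmann, M. Hairer, L. Rey-Bellet, EJP 23 (2018) no. 55, §3 (3.2),
(3.4); F.-Y. Wang, X. Zhang, J. Math. Pures Appl. 99 (2013) 726–740 (arXiv:1107.0096), Thm 1.1;
A. Guillin, F.-Y. Wang, J. Differential Equations 253 (2012) 20–40, Thm 1.1; J.-P. Eckmann,
M. Hairer, Comm. Math. Phys. 212 (2000) 105–164, §3; E. Fournié, J.-M. Lasry, J. Lebuchoux,
P.-L. Lions, N. Touzi, Finance Stoch. 3 (1999) 391–412, Prop. 3.2 (integration-by-parts weights);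
D. Nualart, The Malliavin Calculus and Related Topics (2006), Prop. 2.1.4, §2.3.
-/

noncomputable section

namespace Summit.AtomisticToContinuum.FouriersLaw.Theorems.ExtensiveSnapshotIrreversibility.EnergyWindow

open MeasureTheory ProbabilityTheory Filter Topology Real intervalIntegral
open scoped ENNReal NNReal
open Literature.MathematicalPhysics.KineticTheory.HeatConduction
open Literature.Probability.Process

/-! ## 1. Notation: bath sites, the equal-temperature orbit `u_r = P^0_r h`, the perturbed kernel -/

/-- The left bath site `0 : Fin N` (`N ≥ 2`). [folklore] -/
def leftBath (N : ℕ) (hN : 2 ≤ N) : Fin N := ⟨0, by omega⟩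

/-- The right bath site `N − 1 : Fin N` (`N ≥ 2`). [folklore] -/
def rightBath (N : ℕ) (hN : 2 ≤ N) : Fin N := ⟨N - 1, by omega⟩

/-- `u_r := P^0_r h`, the equal-temperature kernel at real time `r ≥ 0` applied to `h`, as a
function of the starting point. [cite: CuneoEckmannHairerReyBellet2018, eq. (2.3)] -/
def eqKernelFun (ω₂ lam β γ T : ℝ) (N : ℕ) (h : PhaseSpace N → ℝ) (r : ℝ) :
    PhaseSpace N → ℝ :=
  fun w => ∫ y, h y ∂((pinnedChain ω₂ lam β γ).transitionKernel N T T r.toNNReal w)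

/-- The two-temperature kernel `P^δ_s(z, ·)` (baths `T + δ/2`, `T − δ/2`) at real time `s ≥ 0`.
[cite: CuneoEckmannHairerReyBellet2018, eq. (2.3)] -/
def pertKernel (ω₂ lam β γ T δ : ℝ) (N : ℕ) (s : ℝ) (z : PhaseSpace N) :
    Measure (PhaseSpace N) :=
  (pinnedChain ω₂ lam β γ).transitionKernel N (T + δ / 2) (T - δ / 2) s.toNNReal z

/-- The Duhamel integrand at bath site `b` and time `s`:
`∫ ∂_{p_b}(∂_{p_b} P^0_{1−s} h)(w) P^δ_s(z, dw)`.
[cite: CuneoEckmannHairerReyBellet2018, eq. (3.2)] -/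
def duhamelIntegrand (ω₂ lam β γ T δ : ℝ) (N : ℕ) (b : Fin N) (h : PhaseSpace N → ℝ)
    (z : PhaseSpace N) (s : ℝ) : ℝ :=
  ∫ w, partialP b (partialP b (eqKernelFun ω₂ lam β γ T N h (1 - s))) w
    ∂(pertKernel ω₂ lam β γ T δ N s z)

/-- The Duhamel path `Φ(s) := P^δ_s P^0_{1−s} h (z) = ∫ u_{1−s} dP^δ_s(z)`, interpolating
between `P^0_1 h(z)` (`s = 0`) and `P^δ_1 h(z)` (`s = 1`).
[cite: CuneoEckmannHairerReyBellet2018, eq. (3.2)] -/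
def duhamelPath (ω₂ lam β γ T δ : ℝ) (N : ℕ) (h : PhaseSpace N → ℝ) (z : PhaseSpace N)
    (s : ℝ) : ℝ :=
  ∫ w, eqKernelFun ω₂ lam β γ T N h (1 - s) w ∂(pertKernel ω₂ lam β γ T δ N s z)

section Endpoints

variable {ω₂ lam β γ : ℝ} (hω : 0 < ω₂) (hl : 0 < lam) (hβ : 0 < β) (hγ : 0 < γ)
include hω hl hβ hγ

/-- **Left endpoint of the Duhamel path**: `Φ(0) = P^0_1 h(z)` (from `P_0 = id`,
`pinnedChain_transitionKernel_zero`). [cite: CuneoEckmannHairerReyBellet2018, eq. (2.3)] -/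
theorem duhamelPath_zero (T δ : ℝ) (N : ℕ) (h : PhaseSpace N → ℝ) (z : PhaseSpace N) :
    duhamelPath ω₂ lam β γ T δ N h z 0 =
      ∫ y, h y ∂((pinnedChain ω₂ lam β γ).transitionKernel N T T 1 z) := by
  unfold duhamelPath pertKernel eqKernelFun
  rw [Real.toNNReal_zero, integral_transitionKernel_zero hω hl hβ hγ, sub_zero, Real.toNNReal_one]

/-- **Right endpoint of the Duhamel path**: `Φ(1) = P^δ_1 h(z)` (from `P_0 = id`).
[cite: CuneoEckmannHairerReyBellet2018, eq. (2.3)] -/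
theorem duhamelPath_one (T δ : ℝ) (N : ℕ) (h : PhaseSpace N → ℝ) (z : PhaseSpace N) :
    duhamelPath ω₂ lam β γ T δ N h z 1 =
      ∫ y, h y ∂((pinnedChain ω₂ lam β γ).transitionKernel N (T + δ / 2) (T - δ / 2) 1 z) := by
  unfold duhamelPath pertKernel eqKernelFun
  simp only [sub_self, Real.toNNReal_zero, Real.toNNReal_one,
    integral_transitionKernel_zero hω hl hβ hγ]

end Endpoints

/-! ## 2. The three pieces -/

/-- **(D) `KernelTemperatureDuhamel`** (INSTRUMENTABLE; WEAKER than the summit): the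
DIFFERENTIATED second-order perturbation formula on the OPEN time interval — no singular integral
is asserted, all endpoint integrability lives in (G1)/(G1*).  For positive parameters, `T > 0`,
`N ≥ 2`, `0 < θ < 1/T` there is `δ₀ > 0` such that for `|δ| < δ₀` and every measurable
`|h| ≤ e^{θH}`: (i) `∂_{p_b} P^0_r h` is `C¹` for `0 < r ≤ 1` and both bath sites `b`; and for
every `z`: (ii) the path `Φ(s) = P^δ_s P^0_{1−s} h(z)` (endpoint values `P^0_1 h(z)`,
`P^δ_1 h(z)` by `duhamelPath_zero/one`, PROVED) is continuous on `[0, 1]`; (iii) the bath-site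
integrands
`F_b(s) = ∫ ∂²_{p_b}(P^0_{1−s}h) dP^δ_s(z)` are continuous on `(0, 1)`; (iv)
`Φ'(s) = (γδ/2)(F_0(s) − F_{N−1}(s))` on `(0, 1)` (`L^δ − L^0 = (γδ/2)(∂²_{p_0} − ∂²_{p_{N−1}})`,
the friction being temperature-independent).
(after CuneoEckmannHairerReyBellet2018, §3 eq. (3.2)) (after EckmannHairer2000, §3) [route leaf · named hypothesis of this cell, NOT filed as a literature fact] -/
def KernelTemperatureDuhamel : Prop :=
  ∀ ω₂ lam β γ : ℝ, 0 < ω₂ → 0 < lam → 0 < β → 0 < γ →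
    ∀ T : ℝ, 0 < T → ∀ (N : ℕ) (hN : 2 ≤ N), ∀ θ : ℝ, 0 < θ → θ < 1 / T →
      ∃ δ₀ : ℝ, 0 < δ₀ ∧ ∀ δ : ℝ, |δ| < δ₀ →
        ∀ (h : PhaseSpace N → ℝ), Measurable h →
          (∀ y, |h y| ≤ Real.exp (θ * (pinnedChain ω₂ lam β γ).hamiltonian N y)) →
          (∀ r : ℝ, 0 < r → r ≤ 1 → ∀ b : Fin N, (b = leftBath N hN ∨ b = rightBath N hN) →
              ContDiff ℝ 1 (partialP b (eqKernelFun ω₂ lam β γ T N h r))) ∧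
          ∀ z : PhaseSpace N,
            ContinuousOn (duhamelPath ω₂ lam β γ T δ N h z) (Set.Icc 0 1) ∧
            (∀ b : Fin N, (b = leftBath N hN ∨ b = rightBath N hN) →
                ContinuousOn (duhamelIntegrand ω₂ lam β γ T δ N b h z) (Set.Ioo 0 1)) ∧
            ∀ s ∈ Set.Ioo (0 : ℝ) 1,
              HasDerivAt (duhamelPath ω₂ lam β γ T δ N h z)
                (γ * δ / 2 * (duhamelIntegrand ω₂ lam β γ T δ N (leftBath N hN) h z s -
                  duhamelIntegrand ω₂ lam β γ T δ N (rightBath N hN) h z s)) s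

/-- **(G1) `EqualTemperatureBathGradient`** (OPEN · ATTACKABLE-L; WEAKER than the summit): the
Bismut side.  For positive parameters, `T > 0`, `N ≥ 2` and rates `0 < θ < θ₁ < 1/T` there are an
exponent `a < 1` and `C` with `|∂_{p_b} P^0_r h(w)| ≤ C r^{-a} e^{θ₁H(w)}` for all
`0 < r ≤ 1`, all measurable `|h| ≤ e^{θH}`, both bath sites `b`, all `w` (expected `a = ½`).
(after WangZhang2013degenerate, Thm 1.1) (after GuillinWang2012, Thm 1.1)
(after EckmannHairer2000, §3) [route leaf · named hypothesis of this cell, NOT filed as a literature fact] -/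
def EqualTemperatureBathGradient : Prop :=
  ∀ ω₂ lam β γ : ℝ, 0 < ω₂ → 0 < lam → 0 < β → 0 < γ →
    ∀ T : ℝ, 0 < T → ∀ (N : ℕ) (hN : 2 ≤ N), ∀ θ θ₁ : ℝ, 0 < θ → θ < θ₁ → θ₁ < 1 / T →
      ∃ a C : ℝ, a < 1 ∧ ∀ r : ℝ, 0 < r → r ≤ 1 →
        ∀ (h : PhaseSpace N → ℝ), Measurable h →
          (∀ y, |h y| ≤ Real.exp (θ * (pinnedChain ω₂ lam β γ).hamiltonian N y)) →
          ∀ b : Fin N, (b = leftBath N hN ∨ b = rightBath N hN) → ∀ w : PhaseSpace N,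
            |partialP b (eqKernelFun ω₂ lam β γ T N h r) w| ≤
              C * r ^ (-a) * Real.exp (θ₁ * (pinnedChain ω₂ lam β γ).hamiltonian N w)

/-- **(G1*) `PerturbedKernelMomentumIBP`** (OPEN · ATTACKABLE-L; WEAKER than the summit): the
integration-by-parts side, uniform in the temperature perturbation.  For positive parameters,
`T > 0`, `N ≥ 2` and rates `0 < θ₁ < θ₂ < 1/T` there are an exponent `b < 1`, `δ₀ > 0` and
`C` with `|∫ ∂_{p_b} g dP^δ_s(z)| ≤ C s^{-b} M e^{θ₂H(z)}` for `|δ| < δ₀`, `0 < s ≤ 1`, both bath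
sites, all `M ≥ 0`, all `g ∈ C¹` with `|g| ≤ M e^{θ₁H}`, all `z` (expected `b = ½`; `C¹` test
functions only). (after FournieLasryLebuchouxLionsTouzi1999, Prop 3.2)
(after WangZhang2013degenerate, Thm 1.1) (after Nualart2006, Prop 2.1.4) [route leaf · named hypothesis of this cell, NOT filed as a literature fact] -/
def PerturbedKernelMomentumIBP : Prop :=
  ∀ ω₂ lam β γ : ℝ, 0 < ω₂ → 0 < lam → 0 < β → 0 < γ →
    ∀ T : ℝ, 0 < T → ∀ (N : ℕ) (hN : 2 ≤ N), ∀ θ₁ θ₂ : ℝ, 0 < θ₁ → θ₁ < θ₂ → θ₂ < 1 / T →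
      ∃ b₀ δ₀ C : ℝ, b₀ < 1 ∧ 0 < δ₀ ∧ ∀ δ : ℝ, |δ| < δ₀ →
        ∀ s : ℝ, 0 < s → s ≤ 1 → ∀ b : Fin N, (b = leftBath N hN ∨ b = rightBath N hN) →
          ∀ M : ℝ, 0 ≤ M → ∀ g : PhaseSpace N → ℝ, ContDiff ℝ 1 g →
            (∀ w, |g w| ≤ M * Real.exp (θ₁ * (pinnedChain ω₂ lam β γ).hamiltonian N w)) →
            ∀ z : PhaseSpace N,
              |∫ w, partialP b g w ∂(pertKernel ω₂ lam β γ T δ N s z)| ≤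
                C * s ^ (-b₀) * M * Real.exp (θ₂ * (pinnedChain ω₂ lam β γ).hamiltonian N z)

/-! ## 3. The split: `s^{-b} (1−s)^{-a} ≤ 2 s^{-b} + 2 (1−s)^{-a}` and its integrability -/

/-- The endpoint split of the Duhamel singularity: for `0 < s < 1` and exponents
`a, b ≤ 1`, `s^{-b} (1−s)^{-a} ≤ 2 s^{-b} + 2 (1−s)^{-a}` (on `s ≤ ½` the second factor is
`≤ 2`, on `s ≥ ½` the first). [folklore] -/
theorem rpow_neg_mul_one_sub_rpow_neg_le {a b s : ℝ} (ha1 : a ≤ 1) (hb1 : b ≤ 1) (hs0 : 0 < s)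
    (hs1 : s < 1) :
    s ^ (-b) * (1 - s) ^ (-a) ≤ 2 * s ^ (-b) + 2 * (1 - s) ^ (-a) := by
  have h1s : 0 < 1 - s := by linarith
  have hx : 0 ≤ s ^ (-b) := Real.rpow_nonneg hs0.le _
  have hy : 0 ≤ (1 - s) ^ (-a) := Real.rpow_nonneg h1s.le _
  by_cases hs : s ≤ 1 / 2
  · -- `(1 - s)^{-a} ≤ (1 - s)^{-1} ≤ 2`
    have hy2 : (1 - s) ^ (-a) ≤ 2 := by
      calc (1 - s) ^ (-a) ≤ (1 - s) ^ (-1 : ℝ) :=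
            Real.rpow_le_rpow_of_exponent_ge h1s (by linarith) (by linarith)
        _ = (1 - s)⁻¹ := Real.rpow_neg_one _
        _ ≤ 2 := by rw [inv_le_comm₀ h1s (by norm_num)]; linarith
    nlinarith
  · rw [not_le] at hs
    have hx2 : s ^ (-b) ≤ 2 := by
      calc s ^ (-b) ≤ s ^ (-1 : ℝ) :=
            Real.rpow_le_rpow_of_exponent_ge hs0 hs1.le (by linarith)
        _ = s⁻¹ := Real.rpow_neg_one _
        _ ≤ 2 := by rw [inv_le_comm₀ hs0 (by norm_num)]; linarith
    nlinarith

/-- The split majorant `2 s^{-b} + 2 (1−s)^{-a}` is integrable on `[0, 1]` for `a, b < 1`.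
[folklore] -/
theorem intervalIntegrable_split {a b : ℝ} (ha1 : a < 1) (hb1 : b < 1) :
    IntervalIntegrable (fun s : ℝ => 2 * s ^ (-b) + 2 * (1 - s) ^ (-a)) volume 0 1 := by
  have h1 : IntervalIntegrable (fun s : ℝ => s ^ (-b)) volume 0 1 :=
    intervalIntegral.intervalIntegrable_rpow' (by linarith)
  have h2 : IntervalIntegrable (fun s : ℝ => s ^ (-a)) volume 0 1 :=
    intervalIntegral.intervalIntegrable_rpow' (by linarith)
  have h3 : IntervalIntegrable (fun s : ℝ => (1 - s) ^ (-a)) volume 0 1 := by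
    have h := h2.comp_sub_left 1
    norm_num at h
    exact h.symm
  exact (h1.const_mul 2).add (h3.const_mul 2)

/-! ## 4. ★ The composition `(D) ∧ (G1) ∧ (G1*) ⟹ S3` -/

/-- ★ **Route (γ): `(D) → (G1) → (G1*) → S3`.**  Given `0 < θ < θ' < 1/T` put `θ₁ = (θ+θ')/2`;
(G1) bounds `g = ∂_{p_b} P^0_{1−s} h` by `C₁ (1−s)^{-a} e^{θ₁H}`, (G1*) then bounds each Duhamel
integrand by `C₂ s^{-b} C₁ (1−s)^{-a} e^{θ'H(z)}`, the split lemma makes the derivative of the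
Duhamel path integrable on `(0, 1)`, the fundamental theorem of calculus
(`intervalIntegral.integral_eq_sub_of_hasDerivAt_of_le`: continuous on `[0,1]`, differentiable
on `(0,1)`, integrable derivative) turns (D) into the integrated formula, and
`|P^δ_1h(z) − P^0_1h(z)| ≤ (γ|δ|/2) |∫₀¹ 2C₁C₂(2s^{-b} + 2(1−s)^{-a}) ds| e^{θ'H(z)}`.
[folklore] -/
theorem kernelTemperatureLipschitz_of_duhamelSplit (hD : KernelTemperatureDuhamel)
    (hG : EqualTemperatureBathGradient) (hI : PerturbedKernelMomentumIBP) :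
    KernelTemperatureLipschitz := by
  intro ω₂ lam β γ hω hl hβ hγ T hT N hN θ θ' hθ hθθ' hθ'1
  set θ₁ : ℝ := (θ + θ') / 2 with hθ₁
  have hθθ₁ : θ < θ₁ := by rw [hθ₁]; linarith
  have hθ₁θ' : θ₁ < θ' := by rw [hθ₁]; linarith
  have hθ₁1 : θ₁ < 1 / T := hθ₁θ'.trans hθ'1
  obtain ⟨δD, hδD, hDu⟩ := hD ω₂ lam β γ hω hl hβ hγ T hT N hN θ hθ (hθθ'.trans hθ'1)
  obtain ⟨a, C₁, ha1, hG1⟩ := hG ω₂ lam β γ hω hl hβ hγ T hT N hN θ θ₁ hθ hθθ₁ hθ₁1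
  obtain ⟨b₀, δI, C₂, hb1, hδI, hI1⟩ :=
    hI ω₂ lam β γ hω hl hβ hγ T hT N hN θ₁ θ' (hθ.trans hθθ₁) hθ₁θ' hθ'1
  set Hm := (pinnedChain ω₂ lam β γ).hamiltonian N with hHm
  -- the constants are nonnegative (test `h = 0`, `g = 0`)
  have h0m : Measurable (fun _ : PhaseSpace N => (0 : ℝ)) := measurable_const
  have h0b : ∀ y : PhaseSpace N, |(fun _ : PhaseSpace N => (0 : ℝ)) y| ≤ Real.exp (θ * Hm y) :=
    fun y => by simp only [abs_zero]; exact (Real.exp_pos _).le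
  set z₀ : PhaseSpace N := (fun _ => 0, fun _ => 0) with hz₀
  have hC₁ : 0 ≤ C₁ := by
    have h := hG1 1 one_pos le_rfl _ h0m h0b (leftBath N hN) (Or.inl rfl) z₀
    rw [Real.one_rpow, mul_one] at h
    exact nonneg_of_mul_nonneg_left ((abs_nonneg _).trans h) (Real.exp_pos _)
  have hC₂ : 0 ≤ C₂ := by
    have hg0 : ∀ w : PhaseSpace N,
        |(fun _ : PhaseSpace N => (0 : ℝ)) w| ≤ 1 * Real.exp (θ₁ * Hm w) :=
      fun w => by simp only [abs_zero, one_mul]; exact (Real.exp_pos _).le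
    have h := hI1 0 (by simpa using hδI) 1 one_pos le_rfl (leftBath N hN) (Or.inl rfl) 1 zero_le_one
      (fun _ => 0) contDiff_const hg0 z₀
    rw [Real.one_rpow, mul_one, mul_one] at h
    exact nonneg_of_mul_nonneg_left ((abs_nonneg _).trans h) (Real.exp_pos _)
  -- the constant of S3
  set G₀ : ℝ → ℝ := fun s => 2 * (C₁ * C₂) * (2 * s ^ (-b₀) + 2 * (1 - s) ^ (-a)) with hG₀
  have hG₀i : IntervalIntegrable G₀ volume 0 1 := (intervalIntegrable_split ha1 hb1).const_mul _
  refine ⟨min δD δI, γ / 2 * |∫ s in (0 : ℝ)..1, G₀ s|, lt_min hδD hδI,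
    fun δ hδ z g hgm hg => ?_⟩
  have hδD' : |δ| < δD := hδ.trans_le (min_le_left _ _)
  have hδI' : |δ| < δI := hδ.trans_le (min_le_right _ _)
  obtain ⟨hreg, hz⟩ := hDu δ hδD' g hgm hg
  obtain ⟨hcont, hFc, hder⟩ := hz z
  set E : ℝ := Real.exp (θ' * Hm z) with hE
  have hE0 : 0 < E := Real.exp_pos _
  set FL := duhamelIntegrand ω₂ lam β γ T δ N (leftBath N hN) g z with hFL
  set FR := duhamelIntegrand ω₂ lam β γ T δ N (rightBath N hN) g z with hFR
  -- pointwise bound on the Duhamel integrands, `0 < s < 1`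
  have hF : ∀ s : ℝ, 0 < s → s < 1 → ∀ b : Fin N, (b = leftBath N hN ∨ b = rightBath N hN) →
      |duhamelIntegrand ω₂ lam β γ T δ N b g z s| ≤
        C₂ * s ^ (-b₀) * (C₁ * (1 - s) ^ (-a)) * E := by
    intro s hs0 hs1 b hb
    have hr0 : 0 < 1 - s := by linarith
    have hr1 : 1 - s ≤ 1 := by linarith
    have hM : 0 ≤ C₁ * (1 - s) ^ (-a) := mul_nonneg hC₁ (Real.rpow_nonneg hr0.le _)
    exact hI1 δ hδI' s hs0 hs1.le b hb (C₁ * (1 - s) ^ (-a)) hM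
      (partialP b (eqKernelFun ω₂ lam β γ T N g (1 - s))) (hreg (1 - s) hr0 hr1 b hb)
      (fun w => hG1 (1 - s) hr0 hr1 g hgm hg b hb w) z
  have hpt : ∀ s : ℝ, 0 < s → s < 1 → ‖FL s - FR s‖ ≤ G₀ s * E := by
    intro s hs0 hs1
    rw [Real.norm_eq_abs]
    have hL := hF s hs0 hs1 (leftBath N hN) (Or.inl rfl)
    have hR := hF s hs0 hs1 (rightBath N hN) (Or.inr rfl)
    have hsplit := rpow_neg_mul_one_sub_rpow_neg_le ha1.le hb1.le hs0 hs1
    have hCC : 0 ≤ C₁ * C₂ := mul_nonneg hC₁ hC₂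
    calc |FL s - FR s|
        ≤ C₂ * s ^ (-b₀) * (C₁ * (1 - s) ^ (-a)) * E +
            C₂ * s ^ (-b₀) * (C₁ * (1 - s) ^ (-a)) * E := (abs_sub _ _).trans (add_le_add hL hR)
      _ = 2 * (C₁ * C₂) * (s ^ (-b₀) * (1 - s) ^ (-a)) * E := by ring
      _ ≤ 2 * (C₁ * C₂) * (2 * s ^ (-b₀) + 2 * (1 - s) ^ (-a)) * E := by gcongr
      _ = G₀ s * E := by rw [hG₀]
  -- a.e. form on `uIoc 0 1` (the endpoint `s = 1` is a null set: pass to `Ioo 0 1`)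
  have hae : ∀ᵐ s ∂(volume.restrict (Set.uIoc (0 : ℝ) 1)), ‖FL s - FR s‖ ≤ G₀ s * E := by
    rw [Set.uIoc_of_le zero_le_one, ← Measure.restrict_congr_set Ioo_ae_eq_Ioc]
    filter_upwards [ae_restrict_mem measurableSet_Ioo] with s hs
    exact hpt s hs.1 hs.2
  have hFm :
      AEStronglyMeasurable (fun s => FL s - FR s) (volume.restrict (Set.uIoc (0 : ℝ) 1)) := by
    rw [Set.uIoc_of_le zero_le_one, ← Measure.restrict_congr_set Ioo_ae_eq_Ioc]
    exact ((hFc _ (Or.inl rfl)).sub (hFc _ (Or.inr rfl))).aestronglyMeasurable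
      measurableSet_Ioo
  have hFi : IntervalIntegrable (fun s => FL s - FR s) volume 0 1 :=
    (hG₀i.mul_const E).mono_fun' hFm hae
  -- the fundamental theorem of calculus along the Duhamel path
  have hftc := intervalIntegral.integral_eq_sub_of_hasDerivAt_of_le zero_le_one hcont
    (fun s hs => hder s hs) (hFi.const_mul (γ * δ / 2))
  rw [duhamelPath_zero hω hl hβ hγ, duhamelPath_one hω hl hβ hγ,
    intervalIntegral.integral_const_mul] at hftc
  have hint : ‖∫ s in (0 : ℝ)..1, (FL s - FR s)‖ ≤ |∫ s in (0 : ℝ)..1, G₀ s * E| :=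
    intervalIntegral.norm_integral_le_abs_of_norm_le hae (hG₀i.mul_const E)
  rw [intervalIntegral.integral_mul_const, Real.norm_eq_abs, abs_mul, abs_of_pos hE0] at hint
  -- assemble
  rw [← hftc, abs_mul, show |γ * δ / 2| = γ / 2 * |δ| by
    rw [abs_div, abs_mul, abs_of_pos hγ, abs_two]; ring]
  calc γ / 2 * |δ| * |∫ s in (0 : ℝ)..1, (FL s - FR s)|
      ≤ γ / 2 * |δ| * (|∫ s in (0 : ℝ)..1, G₀ s| * E) :=
        mul_le_mul_of_nonneg_left hint (by positivity)
    _ = γ / 2 * |∫ s in (0 : ℝ)..1, G₀ s| * |δ| * E := by ring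

/-! ## 5. The junction through route (γ) -/

/-- **Glue `A0 → A2 → (D) → (G1) → (G1*) → A3p → A4 → (W)`.** [folklore] -/
theorem energyWindowControl_of_atoms₇M (h0 : NessGibbsReweighting) (h2 : NessOddLogRatioBound)
    (hD : KernelTemperatureDuhamel) (hG : EqualTemperatureBathGradient)
    (hI : PerturbedKernelMomentumIBP) (h3p : NessFloorMeanValue) (h4 : NessLinearResponseL2) :
    EnergyWindowControl :=
  energyWindowControl_of_atoms₅K h0 h2 (kernelTemperatureLipschitz_of_duhamelSplit hD hG hI) h3p h4

/-- ★ **The junction `K_fix ⟸ A0 ∧ A2 ∧ (D) ∧ (G1) ∧ (G1*) ∧ A3p ∧ A4`** (route (γ)).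
[folklore] -/
theorem snapshotKLUpperExpansion_of_atoms₇M (h0 : NessGibbsReweighting)
    (h2 : NessOddLogRatioBound) (hD : KernelTemperatureDuhamel)
    (hG : EqualTemperatureBathGradient) (hI : PerturbedKernelMomentumIBP)
    (h3p : NessFloorMeanValue) (h4 : NessLinearResponseL2) : SnapshotKLUpperExpansion :=
  snapshotKLUpperExpansion_of_atoms₅K h0 h2 (kernelTemperatureLipschitz_of_duhamelSplit hD hG hI)
    h3p h4

end Summit.AtomisticToContinuum.FouriersLaw.Theorems.ExtensiveSnapshotIrreversibility.EnergyWindow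

end
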